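import Literature.NumberTheory.DiophantineGeometry.SUnitMordellHeightBoundsModularity
import Literature.NumberTheory.DiophantineGeometry.FaltingsHeight
import Literature.NumberTheory.DiophantineGeometry.Conductor
import Mathlib.Algebra.CubicDiscriminant
import Mathlib.RingTheory.Radical.NatInt
import HarnessLib

/-!
# Power-saving bounds for Mordell's equation, the gap between squares and cubes, the Faltings
# height at integral `j`, and cubic Thue–Mahler equations (Pasten 2026, arXiv v1) — CLAIMS

Topic `Literature/NumberTheory/DiophantineGeometry` (family `abc`, LADDER-ABC A1 — unconditional
`abc`-type bounds; cell abc-stewartyu, seat lit-abc-pasten g4, recent-results harvest). This file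
TYPES, as CLAIM-tagged named statements (`def … : Prop`, D-0012/D-0014; nothing printed in the
source is proved here), the results announced in the introduction (§1) of

* H. Pasten, *Power-saving bounds for Thue–Mahler and Mordell equations*, arXiv:2608.23559v1
  [math.NT], 24 Aug 2026, 44 pp. [`Pasten2026ThueMahlerMordell`]. ALL LOCATORS ARE THE arXiv v1
  NUMBERING (Thm 1.1 `ThmMordell`, Thm 1.2, Thm 1.3 `ThmMordellTruncated`, Thm 1.4 `ThmMordellrad`,
  Conj. 1.5, Thm 1.6 `ThmHeightConj`, Thm 1.7/1.8 `ThmThueMahler1/2`, Cor 1.9 `CoroThueMahler`),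
  read on the TeX source of v1.

## Status — why `[claim: …, status: under-review]` and not `[cite: …]`

The source is an unrefereed preprint (v1, three days old when typed). Its acknowledgments state
(p. 43, §6, verbatim): "In the preparation of this work, AI models were used to suggest initial
exploratory directions, assist with computations, and proofread earlier versions of the manuscript.
The author independently reconstructed and verified all the mathematical content, and assumes full
responsibility for the paper." Under the cell's discipline (typed ≠ proved ≠ endorsed; unrefereed or
AI-assisted results are CANDIDATES, never facts) every statement below that is printed in the source
carries `[claim: Pasten2026ThueMahlerMordell, status: under-review]`; users must treat
`(h : Pasten2026.mordell_log_le_truncTwo)` etc. as open hypotheses until the paper is refereed (then: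
re-tag to `[cite: …]`, no change of statement). What IS kernel-checked (in the proofs companion
`MordellEquationPowerSavingBoundsProofs.lean`) are the three printed one-line deductions
"Thm 1.3 ⟹ Thm 1.1" (`n̲ ≤ |n|`), "Thm 1.3 ⟹ Thm 1.4" (`(n̲)^{1/2} ≤ rad n`) and "Thm 1.1 ⟹ Thm 1.2"
(inversion of the bound), so that Thms 1.1, 1.2, 1.4 are THEOREMS CONDITIONAL ON the single claim
`Pasten2026.mordell_log_le_truncTwo` and register no separate debt; here: the three claims and the
elementary API of Pasten's truncation `n̲` (`truncTwo_le_natAbs`, `truncTwo_le_radical_sq`).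

## What is printed (TeX of v1) and how it is rendered

* Thm 1.3 (the main result on Mordell's equation): "Let `k` be a non-zero integer. The solutions of
  `y² = x³ + k` in `ℤ` satisfy
  `log max{|x|,|y|} ≪ (k̲)^{1/2} (log(2k̲))² log(2|k|) log(k̲ log(3|k|))` where the implicit constant
  is effective and absolute." with `n̲ = ∏_{p ∣ n} p^{min{2, v_p(n)}}` — `Pasten2026.mordell_log_le_truncTwo`;
  `n̲` is von Känel–Matschke's `r₂(n)` at `S = ∅`, i.e. the tree's
  `VonKanelMatschke.coprimePartTrunc ∅ n` (`Pasten2026.truncTwo`, an `abbrev`, with `truncTwo_def`).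
* Thm 1.1: "… `log max{|x|,|y|} ≪ |k|^{1/2} (log(2|k|))⁴` …" ("Since `n̲ ≤ |n|` we see that Theorem 1.1
  is a consequence of [Thm 1.3]") — PROVED from the claim: `Pasten2026.mordell_log_le_sqrt` (companion).
* Thm 1.4: "… `log max{|x|,|y|} ≪ rad(k) (log(2 rad(k)))² log(2|k|) log(rad(k) log(3|k|))` …"
  ("Since `(n̲)^{1/2} ≤ rad(n)` we deduce") — PROVED from the claim: `Pasten2026.mordell_log_le_radical`
  (companion).
* Thm 1.2 (gap between squares and cubes): "For all integers `x, y` with `x³ ≠ y²` we have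
  `|x³ − y²| ≫ (log X)² / (log log X)⁸`, `X = max{3, |x|, |y|}` …" ("An immediate consequence of
  Theorem 1.1") — PROVED from the Thm 1.1 formula (`Pasten2026.cube_sub_sq_ge_of_mordell_log_le_sqrt`)
  and hence from the claim (`Pasten2026.cube_sub_sq_ge`), both in the companion. Context (p. 2): "Before our work,
  all available unconditional lower bounds for `|x³ − y²|` in terms of `X` had the form
  `(log X)^{1−o(1)}`, see for instance [Stark 1973]. … an (admittedly modest) step forward in the
  direction of Hall's conjecture" — the tree's OPEN `HallConjecture` (abc.S17, `AbcWave0`; strength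
  `X^{1/2−ε}`), to which this is not comparable in kind.
* Thm 1.6: "For all elliptic curves `E` over `ℚ` with integral `j`-invariant we have
  `h(E) ≪ N_E^{1/2} (log N_E)⁴` where the implicit constant is absolute and effective."; `h(E)` is
  "its Faltings height relative to `ℚ` as normalized in [Silverman 1986]" = the tree's
  `WeierstrassCurve.faltingsHeight` (same source and normalisation), `N_E = W.conductorNorm ℤ`,
  integral `j` = `∃ b : ℤ, W.j = b` — `Pasten2026.faltingsHeight_le_of_integral_j`. Compare the
  tree's unconditional all-curves bound `MurtyPasten.faltingsHeight_lt` (`0.1 N log N + 11`, the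
  printed (1.1) `h(E) ≪ N_E log N_E`) and `pasten_thm_7_5` (`(1/48+ε) N log N`).
* Cor 1.9, the closing "In particular" clause (the only Thue–Mahler statement free of `D̲`, `R_S`,
  `P⁺`): "Let `F ∈ ℤ[U,V]` be an irreducible binary cubic form with coefficients of absolute value at
  most `H` and let `D` be the absolute value of its discriminant. For all `x, y` coprime integers and
  for every `ε > 0` … `log max{|x|,|y|} ≪_ε log H + e^{(6+ε)Q(x,y)} D^{1/2} (log(2D))⁴`" where
  "`Q(x,y)` is the largest prime factor of `F(x,y)` (or defined as `2` if `F(x,y) = ±1`), and the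
  implicit constant is effective and only depends on `ε`" — `Pasten2026.cubicThueMahler_log_le`, on
  Mathlib's `Cubic ℤ` (`F = aU³ + bU²V + cUV² + dV³`, `D = |Cubic.discr|`, the discriminant of the
  binary cubic form); "irreducible in `ℤ[U,V]`" is rendered `P.a ≠ 0 ∧ Irreducible P.toPoly`
  (dehomogenisation: for `a ≠ 0` the form factorizations of `F` correspond to the factorizations of
  `F(U,1)` in `ℤ[U]`; `a = 0` makes `V ∣ F`); `Q(x,y)` is rendered by quantifying over every
  admissible prime bound `Q ≥ 2` (all prime factors of `F(x,y)` are `≤ Q`), which is equivalent to the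
  printed clause because `F(x,y) ≠ 0` for coprime `(x,y)` and irreducible cubic `F`, and the bound is
  monotone in `Q`. Compare the tree's modularity bound `VonKanelMatschke.corollaryJ` (ii)
  (`2 a_S log a_S + 86 n h(f − m)`, exponential in the primes of `S` through `a_S`).

Faithfulness sheet. `mordell_log_le_truncTwo`, `faltingsHeight_le_of_integral_j`,
`cubicThueMahler_log_le`: FAITHFUL up to (i) "effective" (not expressible; dropped — a WEAKENING, as in
the tree's von Känel typings) and (ii) Vinogradov `≪` read one-sidedly as `LHS ≤ C · RHS` with one
existential absolute `C` (resp. `C = C(ε)`); `^{1/2}` is `Real.sqrt` (`= x^{1/2}`, `Real.sqrt_eq_rpow`).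
For `x = y = 0` (impossible, `k ≠ 0`) `Real.log 0 = 0` is harmless. Thms 1.1/1.2/1.4 are not separate
records (proved consequences in the companion, statements verbatim in the theorem types).
NOT-IN-PRINT: nothing (the constants `2`, `8` and the explicit `c` in the three deductions are ours
and only witness `≪`).

## What is NOT here

Thm 1.7 (version 1: `S`-regulator `R_S` of the cubic field, `P⁺` over the splitting field — no
`S`-regulator carrier in the tree), Thm 1.8 and the first clause of Cor 1.9 (with `D̲`, `Θ`,
`(c(r+1))^{6r}`; typable on demand in the same currency), Thm 2.4 (linear forms in logarithms),
§§3–5 (proofs); Conjecture 1.5 (Frey's height conjecture `h(E) ≤ c log N_E`) is an OPEN conjecture and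
is not Literature (it would be an `@[conjecture]` obligation under `Summits/`). No `abc` claim: these
are Mordell / Hall-direction / height-conjecture-direction bounds, polynomial (not logarithmic) in
`|k|`, `rad k`, `N_E`; bears on LADDER-ABC:A1 only as the current unconditional frontier for these
special shapes. Proof method in print: cubic Thue–Mahler via linear forms in logarithms with Okazaki's
group `𝒪_{K,S}^× ⟨ω⟩` (geometry of numbers applied once, `R_S` not `R_S²`), then Baker–Stark reduction
of Mordell to Thue–Mahler (§4) and the Frey-type translation (5.2) for Thm 1.6 (§5).
-/

noncomputable section

open UniqueFactorizationMonoid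

namespace Literature.NumberTheory.DiophantineGeometry

namespace Pasten2026

/-! ### Pasten's truncation `n̲ = ∏_{p ∣ n} p^{min{2, v_p(n)}}` -/

/-- Pasten's `n̲ = ∏_{p ∣ n} p^{min{2, v_p(n)}}` for a non-zero integer `n` (arXiv:2608.23559v1, §1.1,
display before Thm 1.3; `n̲ = 1` is the harmless junk value at `n = 0`). This is EXACTLY von
Känel–Matschke's `r₂(n) = ∏_{p ∉ S} p^{min(2, ord_p n)}` at `S = ∅`, so it is an abbreviation of the
tree's `VonKanelMatschke.coprimePartTrunc ∅ (n : ℚ)` and not a new notion (`truncTwo_def`).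
[cite: VonkanelMatschke2023, §10.3 (r₂(a)), at S = ∅] -/
abbrev truncTwo (n : ℤ) : ℕ := VonKanelMatschke.coprimePartTrunc ∅ (n : ℚ)

/-- Unfolding: `n̲ = ∏_{p ∣ n} p^{min(2, v_p(n))}` over the prime factors of `|n|`.
[cite: VonkanelMatschke2023, §10.3 (r₂(a)), at S = ∅] -/
theorem truncTwo_def (n : ℤ) :
    truncTwo n = ∏ p ∈ n.natAbs.primeFactors, p ^ min 2 (padicValNat p n.natAbs) := by
  simp [truncTwo, VonKanelMatschke.coprimePartTrunc]

/-- `n̲ ≥ 1`. [cite: VonkanelMatschke2023, §10.3 (r₂(a)), at S = ∅] -/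
theorem truncTwo_pos (n : ℤ) : 0 < truncTwo n := by
  rw [truncTwo_def]
  exact Finset.prod_pos fun p hp => pow_pos (Nat.prime_of_mem_primeFactors hp).pos _

/-- `n̲ ∣ n`. [cite: VonkanelMatschke2023, §10.3 (r₂(a)), at S = ∅] -/
theorem truncTwo_dvd_natAbs (n : ℤ) : truncTwo n ∣ n.natAbs := by
  rw [truncTwo_def]
  by_cases hn : n = 0
  · simp [hn]
  have hn' : n.natAbs ≠ 0 := Int.natAbs_ne_zero.mpr hn
  calc ∏ p ∈ n.natAbs.primeFactors, p ^ min 2 (padicValNat p n.natAbs)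
      ∣ ∏ p ∈ n.natAbs.primeFactors, p ^ n.natAbs.factorization p := by
        refine Finset.prod_dvd_prod_of_dvd _ _ fun p hp => ?_
        rw [Nat.factorization_def _ (Nat.prime_of_mem_primeFactors hp)]
        exact pow_dvd_pow p (min_le_right _ _)
    _ = n.natAbs := by
        conv_rhs => rw [← Nat.prod_factorization_pow_eq_self hn']
        rw [Finsupp.prod, Nat.support_factorization]

/-- "Since `n̲ ≤ |n|`" (arXiv:2608.23559v1, §1.1, before Thm 1.3), for `n ≠ 0`.
[cite: VonkanelMatschke2023, §10.3 (r₂(a)), at S = ∅] -/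
theorem truncTwo_le_natAbs {n : ℤ} (hn : n ≠ 0) : truncTwo n ≤ n.natAbs :=
  Nat.le_of_dvd (Int.natAbs_pos.mpr hn) (truncTwo_dvd_natAbs n)

/-- `n̲ ≤ rad(n)²` (so "`(n̲)^{1/2} ≤ rad(n)`", arXiv:2608.23559v1, §1.1, before Thm 1.4), with
`rad(n) = ∏_{p ∣ n} p` computed in `ℕ` (`UniqueFactorizationMonoid.radical n.natAbs`).
[cite: VonkanelMatschke2023, §10.3 (r₂(a)), at S = ∅] -/
theorem truncTwo_le_radical_sq (n : ℤ) : truncTwo n ≤ radical n.natAbs ^ 2 := by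
  rw [truncTwo_def, Nat.radical_eq_prod_primeFactors, ← Finset.prod_pow]
  exact Finset.prod_le_prod (fun p _ => Nat.zero_le _) fun p hp =>
    pow_le_pow_right₀ (Nat.prime_of_mem_primeFactors hp).one_le (min_le_left _ _)

/-! ### Thm 1.3 (CLAIM): Mordell's equation with truncation -/

/-- **Pasten 2026 (arXiv v1), Theorem 1.3** (Bound for Mordell's equation, with truncation; "the
main result on Mordell's equation in this article"): *"Let `k` be a non-zero integer. The solutions
of `y² = x³ + k` in `ℤ` satisfy
`log max{|x|,|y|} ≪ (k̲)^{1/2} (log(2k̲))² log(2|k|) log(k̲ log(3|k|))`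
where the implicit constant is effective and absolute."* (`k̲ = truncTwo k`; `≪` rendered with one
absolute `C`, effectivity dropped.) Printed context: "von Känel [2014] had a similar bound, but with
a factor `k̲` rather than `(k̲)^{1/2}`" — the tree's `VonKanelMatschke.vonKanel2014_mordell_height_le`
at `S = ∅` (`a_∅ = 36 · 1728 · k̲`). UNREFEREED PREPRINT with declared AI assistance (module
docstring, Status): a CLAIM, to be used only as an explicit hypothesis.
[claim: Pasten2026ThueMahlerMordell, status: under-review] -/
def mordell_log_le_truncTwo : Prop :=
  ∃ C : ℝ, ∀ k : ℤ, k ≠ 0 → ∀ x y : ℤ, y ^ 2 = x ^ 3 + k →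
    Real.log ((max |x| |y| : ℤ) : ℝ) ≤
      C * Real.sqrt (truncTwo k : ℝ) * Real.log (2 * (truncTwo k : ℝ)) ^ 2 *
        Real.log (2 * |(k : ℝ)|) * Real.log ((truncTwo k : ℝ) * Real.log (3 * |(k : ℝ)|))

/-! ### Thm 1.6 (CLAIM): the Faltings height of curves with integral `j`-invariant -/

/-- **Pasten 2026 (arXiv v1), Theorem 1.6** (Bound for the Faltings height): *"For all elliptic
curves `E` over `ℚ` with integral `j`-invariant we have `h(E) ≪ N_E^{1/2} (log N_E)⁴` where the
implicit constant is absolute and effective."* Here `h(E)` is "its Faltings height relative to `ℚ` as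
normalized in [Silverman 1986]" = `WeierstrassCurve.faltingsHeight` (same normalisation and source),
`N_E` = `W.conductorNorm ℤ`, and "integral `j`-invariant" = `W.j ∈ ℤ`. Printed as "a power-saving
improvement on (1.1) `h(E) ≪ N_E log N_E`" [Murty–Pasten 2013 = `MurtyPasten.faltingsHeight_lt`] in
the integral-`j` case, in the direction of Frey's predicted `h(E) ≤ c · log N_E` (item 1.5 of the
source; not a theorem, not vendored). UNREFEREED PREPRINT with declared AI assistance: a CLAIM.
[claim: Pasten2026ThueMahlerMordell, status: under-review] -/
def faltingsHeight_le_of_integral_j : Prop :=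
  ∃ C : ℝ, ∀ (W : WeierstrassCurve ℚ) [W.IsElliptic], (∃ b : ℤ, W.j = b) →
    W.faltingsHeight ≤
      C * Real.sqrt (W.conductorNorm ℤ : ℝ) * Real.log (W.conductorNorm ℤ : ℝ) ^ 4

/-! ### Cor 1.9, "in particular" clause (CLAIM): a simple cubic Thue–Mahler bound -/

/-- **Pasten 2026 (arXiv v1), Corollary 1.9, closing clause** (A simpler Thue–Mahler bound): *"Let
`F ∈ ℤ[U,V]` be an irreducible binary cubic form with coefficients of absolute value at most `H` and
let `D` be the absolute value of its discriminant. For all `x, y` coprime integers and for every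
`ε > 0`, we have … In particular, `log max{|x|,|y|} ≪_ε log H + e^{(6+ε)Q(x,y)} D^{1/2} (log(2D))⁴`"*,
where "`Q(x,y)` is the largest prime factor of `F(x,y)` (or defined as `2` if `F(x,y) = ±1`), and the
implicit constant is effective and only depends on `ε`". Rendering (module docstring): `F` is a
Mathlib `Cubic ℤ` `⟨a,b,c,d⟩` read as `aU³ + bU²V + cUV² + dV³`, irreducible in `ℤ[U,V]` as
`a ≠ 0 ∧ Irreducible F(U,1)`; `H = max |coeff|`, `D = |Cubic.discr|`; `Q(x,y)` is replaced by any
admissible prime bound `Q ≥ 2` (equivalent); `gcd(x,y) = 1` as `Int.gcd x y = 1`. The first clause of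
Cor 1.9 (with `D̲`) and Thms 1.7/1.8 are NOT typed. UNREFEREED PREPRINT with declared AI assistance:
a CLAIM. [claim: Pasten2026ThueMahlerMordell, status: under-review] -/
def cubicThueMahler_log_le : Prop :=
  ∀ ε : ℝ, 0 < ε → ∃ C : ℝ, ∀ P : Cubic ℤ, P.a ≠ 0 → Irreducible P.toPoly →
    ∀ x y : ℤ, Int.gcd x y = 1 → ∀ Q : ℕ, 2 ≤ Q →
      (∀ p : ℕ, p.Prime →
          (p : ℤ) ∣ P.a * x ^ 3 + P.b * x ^ 2 * y + P.c * x * y ^ 2 + P.d * y ^ 3 → p ≤ Q) →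
        Real.log ((max |x| |y| : ℤ) : ℝ) ≤
          C * (Real.log ((max (max |P.a| |P.b|) (max |P.c| |P.d|) : ℤ) : ℝ) +
            Real.exp ((6 + ε) * Q) * Real.sqrt (P.discr.natAbs : ℝ) *
              Real.log (2 * (P.discr.natAbs : ℝ)) ^ 4)


end Pasten2026

end Literature.NumberTheory.DiophantineGeometry

end
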